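import Literature.NumberTheory.GaloisRepresentations.FrobeniusInvariantDivisors
import Literature.NumberTheory.DiophantineGeometry.FunctionFieldZetaEulerProductProofs
import Mathlib.GroupTheory.GroupAction.Period
import HarnessLib

/-!
# The zeta function of a pair `(F, σ)`, I: orbits of places and the Euler product (coefficient form)

Topic `Literature/NumberTheory/GaloisRepresentations`; **proof file** (theorems only; D-0014/D-0026: no
definitions, no named facts).  Sequel of `FrobeniusInvariantDivisors` (same setting: `F/Ω` an algebraic
function field over an algebraically closed field `Ω`, a group `G` acting on `F` stabilising `Ω`, `σ ∈ G`;
here no Frobenius condition on `σ` is needed, only that every place is `σ`-PERIODIC and that the places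
fixed by each `σ^s`, `s ≥ 1`, are FINITE in number — for `F = Ω(C)`, `C/𝔽_q`, `σ = φ^r`, both hold).

* `finite_invariant_effective_degree` — the `σ`-invariant positive divisors of degree `n` form a finite set
  (they live on the finitely many places of period `≤ n`, with coefficients in `[0, n]`;
  `period_mul_apply_le_degree`: `period(P) · A(P) ≤ deg A`).
* `exists_orbitDivisor` — the orbit divisor `O_P = ∑_{i < period} σ^i P`.
* `card_filter_le_apply_eq_invariant` — `A ↦ A - m O_P` is a bijection
  `{A ∈ E_n : A(P) ≥ m} ≃ E_{n - m·period(P)}` (`E_n` = invariant positive divisors of degree `n`).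
* `mul_natCard_invariant_effective_eq_sum` — **the Euler product over the `σ`-orbits, coefficient form**:
  `n A_n^σ = ∑_{r=1}^{n} N_r^σ A_{n-r}^σ` with `A_n^σ = #E_n`, `N_r^σ = #{P : σ^r P = P}` — i.e.
  `∑ A_n^σ tⁿ = ∏_{orbits O} (1 - t^{|O|})⁻¹` through its logarithmic derivative, `∑_{d ∣ r} d #{|O| = d} = N_r^σ`
  (double counting exactly as in the tree's `mul_numEffDivisors_eq_sum`, Stichtenoth Prop. 5.1.8, with
  "degree of a place" replaced by "size of an orbit").

## References
* H. Stichtenoth, *Algebraic Function Fields and Codes*, 2nd ed., GTM 254 (2009), Prop. 5.1.8, eq. (5.40).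
  [Stichtenoth2009]
* M. Rosen, *Number Theory in Function Fields*, GTM 210 (2002), Ch. 5, proof of Thm. 5.12 (Euler product via the
  logarithmic derivative); Ch. 8 (constant field extensions). [RosenFunctionFields2002]
* J. S. Milne, *Jacobian varieties*, in: Arithmetic Geometry (Cornell–Silverman eds.), Springer (1986), §11,
  proof of Thm. 11.1 (`N_m` = number of fixed points of `π^m`). [Milne1986JacobianVarieties]
-/

noncomputable section

open scoped Classical

namespace Literature.NumberTheory.GaloisRepresentations

open Literature.NumberTheory.DiophantineGeometry Literature.NumberTheory.DiophantineGeometry.AlgFunctionField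

universe u v w

attribute [local instance] Finsupp.comapSMul Finsupp.comapMulAction Finsupp.comapDistribMulAction

variable {Ω : Type u} {F : Type v} [Field Ω] [Field F] [Algebra Ω F]
variable {G : Type w} [Group G] [MulSemiringAction G F] [IsConstantStable G Ω F]

/-! ### Orbits of places under `σ` -/

section Orbits

variable (σ : G)

/-- An invariant divisor is constant on `σ`-orbits: `A(σ^i P) = A(P)`. [folklore] -/
theorem apply_pow_smul_of_smul_eq {A : Divisor Ω F} (hA : σ • A = A) (i : ℕ) (P : PlaceOver Ω F) :
    A ((σ ^ i) • P) = A P := by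
  have h : (σ ^ i) • A = A := by
    induction i with
    | zero => rw [pow_zero, one_smul]
    | succ i ih => rw [pow_succ', mul_smul, ih, hA]
  conv_lhs => rw [← h]
  rw [smul_divisor_apply, inv_smul_smul]

/-- The points `σ^i P`, `i < period`, of an orbit are pairwise distinct. [folklore] -/
theorem pow_smul_injOn (P : PlaceOver Ω F) :
    Set.InjOn (fun i : ℕ => (σ ^ i) • P) (Finset.range (MulAction.period σ P) : Set ℕ) := by
  have key : ∀ i j : ℕ, i < MulAction.period σ P → j < MulAction.period σ P →
      (σ ^ i) • P = (σ ^ j) • P → i < j → False := by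
    intro i j hi hj h hij
    have h1 : (σ ^ (j - i)) • P = P := by
      have h2 : (σ ^ i) • ((σ ^ (j - i)) • P) = (σ ^ i) • P := by
        rw [← mul_smul, ← pow_add, Nat.add_sub_cancel' hij.le]; exact h.symm
      exact smul_left_cancel _ h2
    exact MulAction.pow_smul_ne_of_lt_period (Nat.sub_pos_of_lt hij) (lt_of_le_of_lt (Nat.sub_le j i) hj) h1
  intro i hi j hj h
  simp only [Finset.coe_range, Set.mem_Iio] at hi hj
  rcases lt_trichotomy i j with hij | rfl | hij
  · exact (key i j hi hj h hij).elim
  · rfl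
  · exact (key j i hj hi h.symm hij).elim

variable [IsAlgFunctionField Ω F] [IsAlgClosed Ω]

/-- **Orbit bound**: for an invariant positive divisor `A` and a place `P`, `period(P) · A(P) ≤ deg A` (the orbit
of `P` contributes `A(P)` at each of its points; all places are rational). [folklore] -/
theorem period_mul_apply_le_degree {A : Divisor Ω F} (hA0 : 0 ≤ A) (hA : σ • A = A) (P : PlaceOver Ω F) :
    (MulAction.period σ P : ℤ) * A P ≤ A.degree := by
  set s := MulAction.period σ P with hs
  have hdeg : A.degree = ∑ Q ∈ A.support, A Q := by
    rw [Divisor.degree_apply, Finsupp.sum]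
    refine Finset.sum_congr rfl fun Q _ => ?_
    rw [PlaceOver.isRational_of_isAlgClosed Q, Nat.cast_one, mul_one]
  rcases eq_or_ne (A P) 0 with h0 | h0
  · rw [h0, mul_zero, hdeg]; exact Finset.sum_nonneg fun Q _ => hA0 Q
  have himg : (Finset.range s).image (fun i : ℕ => (σ ^ i) • P) ⊆ A.support := by
    intro Q hQ
    obtain ⟨i, -, rfl⟩ := Finset.mem_image.1 hQ
    rw [Finsupp.mem_support_iff, apply_pow_smul_of_smul_eq σ hA]; exact h0
  calc (s : ℤ) * A P = ∑ i ∈ Finset.range s, A ((σ ^ i) • P) := by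
        simp only [apply_pow_smul_of_smul_eq σ hA, Finset.sum_const, Finset.card_range, nsmul_eq_mul]
    _ = ∑ Q ∈ (Finset.range s).image (fun i : ℕ => (σ ^ i) • P), A Q :=
        (Finset.sum_image fun i hi j hj h => pow_smul_injOn σ P hi hj h).symm
    _ ≤ ∑ Q ∈ A.support, A Q := Finset.sum_le_sum_of_subset_of_nonneg himg fun Q _ _ => hA0 Q
    _ = A.degree := hdeg.symm

/-- For an invariant positive divisor `A` of degree `n` and a place `P` in its support, the period of `P` is
`≤ n`. [folklore] -/
theorem period_le_of_apply_ne_zero {A : Divisor Ω F} (hA0 : 0 ≤ A) (hA : σ • A = A) {n : ℕ}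
    (hdeg : A.degree = n) {P : PlaceOver Ω F} (hP : A P ≠ 0) : MulAction.period σ P ≤ n := by
  have h1 : (1 : ℤ) ≤ A P := by
    have := hA0 P; simp only [Finsupp.coe_zero, Pi.zero_apply] at this; omega
  have h2 := period_mul_apply_le_degree σ hA0 hA P
  rw [hdeg] at h2
  have h3 : (MulAction.period σ P : ℤ) ≤ n := by nlinarith
  exact_mod_cast h3

variable (hper : ∀ P : PlaceOver Ω F, ∃ s, 0 < s ∧ (σ ^ s) • P = P)
  (hfin : ∀ s, 0 < s → Finite {P : PlaceOver Ω F // (σ ^ s) • P = P})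

include hper in
omit [IsAlgFunctionField Ω F] [IsAlgClosed Ω] in
/-- Every place has a positive period. [folklore] -/
theorem period_pos (P : PlaceOver Ω F) : 0 < MulAction.period σ P := by
  obtain ⟨s, hs, h⟩ := hper P
  exact MulAction.period_pos_of_fixed hs h

include hfin in
omit [IsAlgFunctionField Ω F] [IsAlgClosed Ω] in
/-- The places of period at most `n` form a finite set. [folklore] -/
theorem finite_setOf_period_le (n : ℕ) :
    {P : PlaceOver Ω F | ∃ s, 0 < s ∧ s ≤ n ∧ (σ ^ s) • P = P}.Finite := by
  have h : {P : PlaceOver Ω F | ∃ s, 0 < s ∧ s ≤ n ∧ (σ ^ s) • P = P} ⊆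
      ⋃ s ∈ (Finset.Icc 1 n : Set ℕ), {P : PlaceOver Ω F | (σ ^ s) • P = P} := by
    rintro P ⟨s, hs, hsn, h⟩
    exact Set.mem_biUnion (Finset.mem_coe.2 (Finset.mem_Icc.2 ⟨hs, hsn⟩)) h
  refine Set.Finite.subset (Set.Finite.biUnion (Finset.finite_toSet _) fun s hs => ?_) h
  have hs' : 0 < s := (Finset.mem_Icc.1 (Finset.mem_coe.1 hs)).1
  haveI := hfin s hs'
  exact Set.finite_coe_iff.1 (inferInstanceAs (Finite {P : PlaceOver Ω F // (σ ^ s) • P = P}))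

include hper hfin in
/-- **The `σ`-invariant positive divisors of degree `n` form a finite set** (they are supported on the finitely
many places of period `≤ n`, with coefficients in `[0, n]`). [folklore] -/
theorem finite_invariant_effective_degree (n : ℕ) :
    Finite {A : Divisor Ω F // 0 ≤ A ∧ σ • A = A ∧ A.degree = n} := by
  set S := {P : PlaceOver Ω F | ∃ s, 0 < s ∧ s ≤ n ∧ (σ ^ s) • P = P} with hS
  haveI : Finite S := (finite_setOf_period_le σ hfin n).to_subtype
  have hmem : ∀ (A : Divisor Ω F), 0 ≤ A → σ • A = A → A.degree = n → ∀ P, A P ≠ 0 → P ∈ S := by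
    intro A hA0 hA hdeg P hP
    exact ⟨MulAction.period σ P, period_pos σ hper P, period_le_of_apply_ne_zero σ hA0 hA hdeg hP,
      MulAction.pow_period_smul σ P⟩
  have hbd : ∀ (A : {A : Divisor Ω F // 0 ≤ A ∧ σ • A = A ∧ A.degree = n}) (P : PlaceOver Ω F),
      (A.1 P).toNat < n + 1 := fun A P => by
    have h1 : A.1 P ≤ A.1.degree := Divisor.apply_le_degree A.2.1 P
    rw [A.2.2.2] at h1
    have h2 : 0 ≤ A.1 P := A.2.1 P
    omega
  refine Finite.of_injective
    (fun (A : {A : Divisor Ω F // 0 ≤ A ∧ σ • A = A ∧ A.degree = n}) (P : S) =>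
      (⟨(A.1 P.1).toNat, hbd A P.1⟩ : Fin (n + 1))) ?_
  intro A A' h
  apply Subtype.ext
  ext P
  by_cases hP : P ∈ S
  · have h1 := congrFun h ⟨P, hP⟩
    simp only [Fin.mk.injEq] at h1
    have h2 : 0 ≤ A.1 P := A.2.1 P
    have h3 : 0 ≤ A'.1 P := A'.2.1 P
    omega
  · have h1 : A.1 P = 0 := by by_contra h1; exact hP (hmem A.1 A.2.1 A.2.2.1 A.2.2.2 P h1)
    have h2 : A'.1 P = 0 := by by_contra h2; exact hP (hmem A'.1 A'.2.1 A'.2.2.1 A'.2.2.2 P h2)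
    rw [h1, h2]

/-! ### The orbit divisor of a place -/

/-- **The orbit divisor `O_P = ∑_{i < s} σ^i P`** (`s > 0` the period of `P`): `σ`-invariant, of degree `s`,
`O_P(P) = 1`, and with values in `{0, 1}`, the value `1` exactly on the orbit. [folklore] -/
theorem exists_orbitDivisor {P : PlaceOver Ω F} (hs : 0 < MulAction.period σ P) :
    ∃ O : Divisor Ω F, σ • O = O ∧ O.degree = MulAction.period σ P ∧ O P = 1 ∧
      ∀ Q, O Q = 0 ∨ (O Q = 1 ∧ ∃ i, Q = (σ ^ i) • P) := by
  set s := MulAction.period σ P with hsdef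
  let f : ℕ → Divisor Ω F := fun i => Finsupp.single ((σ ^ i) • P) 1
  set O : Divisor Ω F := ∑ i ∈ Finset.range s, f i with hO
  have hOapply : ∀ Q, O Q = (((Finset.range s).filter fun i => (σ ^ i) • P = Q).card : ℤ) := by
    intro Q
    rw [hO, Finsupp.finsetSum_apply]
    simp only [f, Finsupp.single_apply, Finset.sum_boole]
  have hcard_le : ∀ Q, ((Finset.range s).filter fun i => (σ ^ i) • P = Q).card ≤ 1 := by
    intro Q
    rw [Finset.card_le_one]
    intro i hi j hj
    rw [Finset.mem_filter] at hi hj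
    exact pow_smul_injOn σ P (Finset.mem_coe.2 hi.1) (Finset.mem_coe.2 hj.1) (hi.2.trans hj.2.symm)
  refine ⟨O, ?_, ?_, ?_, fun Q => ?_⟩
  · -- invariance: reindex `i ↦ i + 1`, using `σ^s P = P`
    have hf : ∀ i, σ • f i = f (i + 1) := fun i => by
      simp only [f, Finsupp.comapSMul_single, ← mul_smul, ← pow_succ']
    have hfs : f s = f 0 := by simp only [f, pow_zero, one_smul, hsdef, MulAction.pow_period_smul]
    rw [hO, Finset.smul_sum]
    simp only [hf]
    calc ∑ i ∈ Finset.range s, f (i + 1) = (∑ i ∈ Finset.range (s + 1), f i) - f 0 := by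
          rw [Finset.sum_range_succ']; abel
      _ = ∑ i ∈ Finset.range s, f i := by rw [Finset.sum_range_succ, hfs]; abel
  · have hdeg1 : ∀ Q : PlaceOver Ω F, (Q.degree : ℤ) = 1 := fun Q => by
      rw [PlaceOver.isRational_of_isAlgClosed Q, Nat.cast_one]
    rw [hO, map_sum]
    simp only [f, Divisor.degree_single, hdeg1, mul_one, Finset.sum_const, Finset.card_range, nsmul_eq_mul]
  · rw [hOapply]
    have h1 : ((Finset.range s).filter fun i => (σ ^ i) • P = P) = {0} := by
      refine Finset.eq_singleton_iff_unique_mem.2 ⟨?_, fun i hi => ?_⟩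
      · rw [Finset.mem_filter, Finset.mem_range, pow_zero, one_smul]; exact ⟨hs, rfl⟩
      · rw [Finset.mem_filter, Finset.mem_range] at hi
        by_contra hi0
        exact MulAction.pow_smul_ne_of_lt_period (Nat.pos_of_ne_zero hi0) hi.1 hi.2
    rw [h1, Finset.card_singleton, Nat.cast_one]
  · rw [hOapply]
    rcases Nat.eq_zero_or_pos ((Finset.range s).filter fun i => (σ ^ i) • P = Q).card with h0 | hpos
    · left; rw [h0, Nat.cast_zero]
    · right
      refine ⟨by rw [le_antisymm (hcard_le Q) hpos, Nat.cast_one], ?_⟩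
      obtain ⟨i, hi⟩ := Finset.card_pos.1 hpos
      rw [Finset.mem_filter] at hi
      exact ⟨i, hi.2.symm⟩

/-! ### The Euler product, coefficient form: `n A_n^σ = ∑_{r=1}^{n} N_r^σ A_{n-r}^σ` -/

include hper in
/-- **Geometric series over an orbit.**  For a place `P` of period `s` and `m ≥ 1`, the shift `A ↦ A - m O_P`
is a bijection from the invariant positive divisors `A` of degree `n` with `A(P) ≥ m` onto the invariant
positive divisors of degree `n - m s`, and there are none of the former if `m s > n`.  (`E k` = the finite
set of invariant positive divisors of degree `k`.) [cite: Stichtenoth2009, Prop. 5.1.8 (proof)] -/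
theorem card_filter_le_apply_eq_invariant {n m : ℕ} (P : PlaceOver Ω F) (E : ℕ → Finset (Divisor Ω F))
    (hE : ∀ k A, A ∈ E k ↔ 0 ≤ A ∧ σ • A = A ∧ A.degree = k) :
    ((E n).filter fun A => (m : ℤ) ≤ A P).card =
      if m * MulAction.period σ P ≤ n then (E (n - m * MulAction.period σ P)).card else 0 := by
  set s := MulAction.period σ P with hsdef
  have hs : 0 < s := period_pos σ hper P
  obtain ⟨O, hσO, hdegO, hOP, hOQ⟩ := exists_orbitDivisor σ hs
  split_ifs with h
  · apply Finset.card_nbij' (fun A => A - m • O) (fun B => B + m • O)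
    · intro A hA
      rw [Finset.mem_coe, Finset.mem_filter, hE] at hA
      obtain ⟨⟨hA0, hσA, hAdeg⟩, hAm⟩ := hA
      rw [Finset.mem_coe, hE]
      refine ⟨fun Q => ?_, by rw [smul_sub, smul_comm σ m O, hσO, hσA], ?_⟩
      · simp only [Finsupp.coe_sub, Finsupp.coe_zero, Pi.sub_apply, Pi.zero_apply, Finsupp.smul_apply, nsmul_eq_mul]
        rcases hOQ Q with hQ | ⟨hQ, i, rfl⟩
        · rw [hQ, mul_zero, sub_zero]; exact hA0 Q
        · rw [hQ, mul_one, apply_pow_smul_of_smul_eq σ hσA]; linarith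
      · rw [map_sub, map_nsmul, hAdeg, hdegO, Nat.cast_sub h, Nat.cast_mul, nsmul_eq_mul]
    · intro B hB
      rw [Finset.mem_coe, hE] at hB
      obtain ⟨hB0, hσB, hBdeg⟩ := hB
      rw [Finset.mem_coe, Finset.mem_filter, hE]
      refine ⟨⟨fun Q => ?_, by rw [smul_add, smul_comm σ m O, hσO, hσB], ?_⟩, ?_⟩
      · simp only [Finsupp.coe_add, Finsupp.coe_zero, Pi.add_apply, Pi.zero_apply, Finsupp.smul_apply, nsmul_eq_mul]
        have := hB0 Q
        simp only [Finsupp.coe_zero, Pi.zero_apply] at this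
        rcases hOQ Q with hQ | ⟨hQ, -⟩
        · rw [hQ, mul_zero, add_zero]; exact this
        · rw [hQ, mul_one]; positivity
      · rw [map_add, map_nsmul, hBdeg, hdegO, Nat.cast_sub h, Nat.cast_mul, nsmul_eq_mul]
        ring
      · have := hB0 P
        simp only [Finsupp.coe_zero, Pi.zero_apply] at this
        simp only [Finsupp.coe_add, Pi.add_apply, Finsupp.smul_apply, nsmul_eq_mul, hOP, mul_one]
        linarith
    · intro A _
      simp
    · intro B _
      simp
  · rw [Finset.card_eq_zero, Finset.filter_eq_empty_iff]
    intro A hA hle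
    rw [hE] at hA
    obtain ⟨hA0, hσA, hAdeg⟩ := hA
    have h1 := period_mul_apply_le_degree σ hA0 hσA P
    rw [hAdeg, ← hsdef] at h1
    have h2 : (s : ℤ) * m ≤ s * A P := mul_le_mul_of_nonneg_left hle (Nat.cast_nonneg _)
    have h3 : ((m * s : ℕ) : ℤ) ≤ n := by push_cast; linarith
    exact h (by exact_mod_cast h3)

include hper hfin in
/-- **The Euler product over the `σ`-orbits, coefficient form** — for the numbers `A_n^σ` of `σ`-invariant
positive divisors of degree `n` and `N_r^σ = #{P : σ^r P = P}` of places fixed by `σ^r`: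
`n · A_n^σ = ∑_{r=1}^{n} N_r^σ · A_{n-r}^σ`.  (The invariant positive divisors form the free commutative monoid
on the `σ`-orbits of places, an orbit of size `d` having degree `d`, so `∑ A_n^σ t^n = ∏_{orbits} (1 - t^{|O|})⁻¹`;
logarithmic derivative, with `∑_{d ∣ r} d · #{orbits of size d} = N_r^σ`.  Proof by double counting as in the
tree's `mul_numEffDivisors_eq_sum`.) [cite: Stichtenoth2009, Prop. 5.1.8]
[cite: Milne1986JacobianVarieties, §11 (proof of Thm. 11.1)] -/
theorem mul_natCard_invariant_effective_eq_sum (n : ℕ) :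
    n * Nat.card {A : Divisor Ω F // 0 ≤ A ∧ σ • A = A ∧ A.degree = n} =
      ∑ r ∈ Finset.Icc 1 n, Nat.card {P : PlaceOver Ω F // (σ ^ r) • P = P} *
        Nat.card {A : Divisor Ω F // 0 ≤ A ∧ σ • A = A ∧ A.degree = (n - r : ℕ)} := by
  -- the finite sets `E k` of invariant positive divisors of degree `k`
  have hEfin : ∀ k : ℕ, {A : Divisor Ω F | 0 ≤ A ∧ σ • A = A ∧ A.degree = k}.Finite := fun k =>
    Set.finite_coe_iff.1 (finite_invariant_effective_degree σ hper hfin k)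
  set E : ℕ → Finset (Divisor Ω F) := fun k => (hEfin k).toFinset with hEdef
  have hE : ∀ k A, A ∈ E k ↔ 0 ≤ A ∧ σ • A = A ∧ A.degree = k := fun k A => by
    rw [hEdef, Set.Finite.mem_toFinset]; rfl
  have hAk : ∀ k : ℕ, Nat.card {A : Divisor Ω F // 0 ≤ A ∧ σ • A = A ∧ A.degree = k} = (E k).card := fun k =>
    Nat.card_eq_card_finite_toFinset (hEfin k)
  -- the finite set `S` of places of period `≤ n`
  set S : Finset (PlaceOver Ω F) := (finite_setOf_period_le σ hfin n).toFinset with hSdef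
  have hS : ∀ P, P ∈ S ↔ ∃ s, 0 < s ∧ s ≤ n ∧ (σ ^ s) • P = P := fun P => by
    rw [hSdef, Set.Finite.mem_toFinset]; rfl
  have hmemS : ∀ A ∈ E n, ∀ P, A P ≠ 0 → P ∈ S := by
    intro A hA P hP
    rw [hE] at hA
    exact (hS P).2 ⟨MulAction.period σ P, period_pos σ hper P, period_le_of_apply_ne_zero σ hA.1 hA.2.1 hA.2.2 hP,
      MulAction.pow_period_smul σ P⟩
  -- `N_r` as a count inside `S`
  have hNr : ∀ r ∈ Finset.Icc 1 n,
      Nat.card {P : PlaceOver Ω F // (σ ^ r) • P = P} = (S.filter fun P => (σ ^ r) • P = P).card := by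
    intro r hr
    rw [Finset.mem_Icc] at hr
    rw [← Nat.card_eq_finsetCard]
    refine Nat.card_congr (Equiv.subtypeEquivRight fun P => ?_)
    rw [Finset.mem_filter]
    refine ⟨fun h => ⟨(hS P).2 ⟨MulAction.period σ P, MulAction.period_pos_of_fixed hr.1 h,
      (MulAction.period_le_of_fixed hr.1 h).trans hr.2, MulAction.pow_period_smul σ P⟩, h⟩, fun h => h.2⟩
  -- Step 1–2 (left-hand side): `n · A_n = ∑_{P ∈ S} ∑_{m=1}^{n} #{A ; m ≤ A(P)}`
  have hL : (n : ℤ) * (E n).card =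
      ∑ P ∈ S, ∑ m ∈ Finset.Icc 1 n, (((E n).filter fun A => (m : ℤ) ≤ A P).card : ℤ) := by
    calc (n : ℤ) * (E n).card = ∑ A ∈ E n, A.degree := by
          rw [Finset.sum_congr rfl fun A hA => ((hE n A).mp hA).2.2, Finset.sum_const, nsmul_eq_mul, mul_comm]
      _ = ∑ A ∈ E n, ∑ P ∈ S, A P := by
          refine Finset.sum_congr rfl fun A hA => ?_
          rw [Divisor.degree_apply]
          rw [Finsupp.sum_of_support_subset A (fun P hP => hmemS A hA P (Finsupp.mem_support_iff.1 hP)) _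
            fun P _ => by simp]
          refine Finset.sum_congr rfl fun P _ => ?_
          rw [PlaceOver.isRational_of_isAlgClosed P, Nat.cast_one, mul_one]
      _ = ∑ P ∈ S, ∑ A ∈ E n, A P := Finset.sum_comm
      _ = ∑ P ∈ S, ∑ m ∈ Finset.Icc 1 n, (((E n).filter fun A => (m : ℤ) ≤ A P).card : ℤ) := by
          refine Finset.sum_congr rfl fun P _ => ?_
          calc ∑ A ∈ E n, A P = ∑ A ∈ E n, ∑ m ∈ Finset.Icc 1 n, if (m : ℤ) ≤ A P then (1 : ℤ) else 0 :=
                Finset.sum_congr rfl fun A hA => apply_eq_sum_Icc_ite ((hE n A).mp hA).1 ((hE n A).mp hA).2.2 P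
            _ = ∑ m ∈ Finset.Icc 1 n, (((E n).filter fun A => (m : ℤ) ≤ A P).card : ℤ) := by
                rw [Finset.sum_comm]
                exact Finset.sum_congr rfl fun m _ => Finset.sum_boole _ _
  -- Step 3–4: each inner sum is `∑_{r=1}^{n} [period P ∣ r] A_{n-r}`
  have hP : ∀ P ∈ S, ∑ m ∈ Finset.Icc 1 n, (((E n).filter fun A => (m : ℤ) ≤ A P).card : ℤ) =
      ((∑ r ∈ Finset.Icc 1 n, if MulAction.period σ P ∣ r then (E (n - r)).card else 0 : ℕ) : ℤ) := by
    intro P _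
    rw [← sum_Icc_ite_mul_le_eq_sum_Icc_ite_dvd n (period_pos σ hper P) fun k => (E k).card, Nat.cast_sum]
    refine Finset.sum_congr rfl fun m _ => ?_
    rw [card_filter_le_apply_eq_invariant σ hper P E hE]
  -- Step 5 (right-hand side)
  have hR : ∑ r ∈ Finset.Icc 1 n, Nat.card {P : PlaceOver Ω F // (σ ^ r) • P = P} * (E (n - r)).card =
      ∑ P ∈ S, ∑ r ∈ Finset.Icc 1 n, if MulAction.period σ P ∣ r then (E (n - r)).card else 0 := by
    rw [Finset.sum_comm]
    refine Finset.sum_congr rfl fun r hr => ?_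
    rw [hNr r hr, Finset.card_filter, Finset.sum_mul]
    refine Finset.sum_congr rfl fun P _ => ?_
    rw [MulAction.pow_smul_eq_iff_period_dvd]
    split_ifs <;> simp
  -- assemble
  simp only [hAk]
  rw [hR]
  apply Nat.cast_injective (R := ℤ)
  push_cast
  rw [hL]
  refine Finset.sum_congr rfl fun P hPS => ?_
  rw [hP P hPS]
  push_cast
  rfl

end Orbits

end Literature.NumberTheory.GaloisRepresentations
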